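import Summits.ABC.IUTFork.LanaPadicPairAutomorphisms
import Summits.ABC.IUTFork.LanaCyclotomicRigidityModel
import Literature.AnabelianGeometry.AbsoluteAnabelian.GaloisCyclotomeTransportNaturalityAnyData
import Literature.AnabelianGeometry.AbsoluteAnabelian.AbsAnabUnitsTransportUnique
import Literature.AnabelianGeometry.AbsoluteAnabelian.AbsAnabUnitsTransportHolds
import Literature.AnabelianGeometry.EtaleTheta.CyclotomeZHatEquiv
import Literature.NumberTheory.GaloisRepresentations.LocalFieldPadicProofs
import HarnessLib

/-!
# L-LANA objects X ter: LANA's cyclotomic rigidity `ι_{G↷M}` is NATURAL under every automorphism of `F_v = (G_v ↷ O^▷_v)` — and NOT under those of `F^{⊢×}_v = (G_v ↷ O^×_v)`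

Record-only, proof-only sequel (D-0012; seat abc-iut-c312-4 gen 6, L-LANA level, plan/LLANA-SPEC N2/N9/N12) of
`LanaCyclotomicRigidityModel.lean` (gen 5: `ι_{G_k ↷ O^×} = iotaOfReciprocity D w : Λ(O^×_{k̄}) ⥲ μ_Ẑ(G_k)` from
torsion reciprocity data `D`, LANA §6.3 (6-5) p. 37) and `LanaPadicPairAutomorphisms.lean` (gen 6: every automorphism
`e = (e_G, e_M)` of the `ℚ_p` pair `(G_{ℚ_p} ↷ O^▷_{ℚ̄_p})` extends to an `e_G`-equivariant `ψ_e : ℚ̄_pˣ ⥲ ℚ̄_pˣ`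
preserving `|·|_p`).  TAKES NO SIDE on [IUTchIII] Cor. 3.12.  LANA §6.3 p. 37: "Cyclotomic rigidity is the
canonical isomorphism … `ι_{G↷M} : Λ(M) ⥲ Λ(G)` … without this rigidity, `Λ(M)` can be recovered only up to its
`Ẑ^×`-orbit"; [AbsTopIII] Rmk. 3.2.1 p. 73 (the isomorphism is functorial = compatible with isomorphisms of
pairs) vs Prop. 3.3 (i) p. 73 ("for `T = TCG` [the unit group] the natural isomorphism `μ_Ẑ(M) ⥲ μ_Ẑ(G)` is only
determined up to a `Ẑ^×`-multiple"), [IUTchII] Rmk. 1.11.1 (i) (b).  THIS file makes both halves kernel theorems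
at the `ℚ_p` datum:

* §1 `PadicPairIso.extEquiv_eq_of_isAlphaEquivariant`, `extEquiv_preservesUniformizers` — the extension `ψ_e` of
  ANY pair automorphism IS the local-class-field-theory transport `ψ̄_{e_G}` of [AbsAnab] Prop. 1.2.1 (layer L4
  `Prop121vii.unitsTransport_holds`, uniqueness up to inversion `IsAlphaEquivariant.eq_or_eq_inv` of abc-iut-L6-t13;
  the inversion branch is excluded because `ψ_e` preserves `|·|_p`, gen 6) — so `ψ_e` carries uniformisers to
  uniformisers and `O^×` onto `O^×`;
* §2 `iotaOfReciprocity_natural` — for EVERY torsion reciprocity datum `D`, every topological automorphism `φ`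
  of `G_k` and every `φ`-equivariant uniformiser-preserving `ψ`: `ι(Λ(ψ) ζ) = μ_Ẑ(φ)(ι ζ)` (layer L6-t11's
  `muZhatEquiv_congr_natural`, p427570, consumed BY NAME); hence **`iotaOfReciprocity_natural_padicPair`: LANA's `ι`
  commutes with the transport of structure along EVERY automorphism of the GM-data `F_v = (G_{ℚ_p} ↷ O^▷_{ℚ̄_p})`**
  — the mono-anabelian meaning of "canonical";
* §3 NEGATIVE companion — `unitGrpInv_smul`: inversion `u ↦ u⁻¹` is a `G`-EQUIVARIANT automorphism of the unit
  GM-data `F^{⊢×}_v = (G_v ↷ O^×_v)` (over `e_G = id`), `iotaOfReciprocity_cyclotome_map_inv`: under it `ι` picks up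
  the sign `ι(Λ(inv) ζ) = (ι ζ)⁻¹`, and `not_iota_natural_unitGrpInv`: this is NOT `ι ζ` (a generator of
  `Λ(O^×_{ℚ̄_p}) ≅ Ẑ` has a primitive cube root as third component; the tree's `EtaleTheta.cyclotome.exists_generator`) — the
  element `-1 ∈ Ẑ^×` of print's indeterminacy, kernel-visible: the UNIT portion alone does not rigidify the
  cyclotome, the valuation-bearing monoid `O^▷` does.

The hypothesis class `[IsNonarchimedeanLocalField ℚ_[p]]` in §1–§2 is inhabited (the tree's
`Padic.isNonarchimedeanLocalField_holds`); it is a binder only because instances are not declared in this file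
(`isValPreserving_absoluteGaloisGroup_padic` likewise supplies gen 5's `[IsValPreserving · (absoluteGaloisGroup ℚ_[p])]`).
[cite: LANA2026Report, §6.3 (6-5) p. 37, Def. 3.7.1 p. 20] [cite: MochizukiAbsTopIII2015, Remark 3.2.1 p.73]
[cite: MochizukiAbsTopIII2015, Proposition 3.3 (i) p.73] [cite: MochizukiAbsAnab2004, Prop 1.2.1 (vi) p.10]
NOT here: any judgement.
-/

noncomputable section

namespace Summit.ABC
namespace IUTFork

open Literature.AnabelianGeometry Literature.AnabelianGeometry.AbsoluteAnabelian Field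
open scoped NNReal

/-! ## 1. `ψ_e` is THE class-field-theoretic transport -/

namespace PadicPairIso

variable (p : ℕ) [Fact p.Prime] (e : GaloisMonoidPair.Iso (padicPair p) (padicPair p))

/-- `ψ_e` is `e_G`-equivariant in layer L4's sense ([AbsAnab] Prop. 1.2.1 (vi) "Galois-equivariant with respect to
`α`"). [cite: MochizukiAbsAnab2004, Prop 1.2.1 (vi) p.10] -/
theorem extEquiv_isAlphaEquivariant : Prop121vii.IsAlphaEquivariant (galComponent p e) (extEquiv p e) :=
  fun σ x => extEquiv_smul p e σ x

/-- A uniformiser of `ℚ_p` has norm `< 1`. [folklore] -/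
theorem norm_lt_one_of_isUniformizer [IsNonarchimedeanLocalField ℚ_[p]] {π : ℚ_[p]}
    (hπ : (ValuativeRel.valuation ℚ_[p]).IsUniformizer π) : ‖π‖ < 1 := by
  have hle : ‖π‖ ≤ 1 :=
    (Literature.NumberTheory.GaloisRepresentations.Padic.mem_valuationInteger_iff p π).mp
      ((Valuation.mem_integer_iff _ _).mpr hπ.val_lt_one.le)
  refine lt_of_le_of_ne hle fun h1 => ?_
  have hinv := (Literature.NumberTheory.GaloisRepresentations.Padic.mem_valuationInteger_iff p π⁻¹).mpr
    (by rw [norm_inv, h1, inv_one])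
  have hv : ValuativeRel.valuation ℚ_[p] π⁻¹ ≤ 1 := (Valuation.mem_integer_iff _ _).mp hinv
  rw [map_inv₀, inv_le_one₀ hπ.val_pos] at hv
  exact absurd hπ.val_lt_one (not_lt.mpr hv)

/-- `ℚ_p` has a uniformiser (as a unit). [folklore] -/
theorem exists_unit_isUniformizer [IsNonarchimedeanLocalField ℚ_[p]] :
    ∃ π : ℚ_[p]ˣ, (ValuativeRel.valuation ℚ_[p]).IsUniformizer (π : ℚ_[p]) := by
  obtain ⟨π, hπ⟩ := Valuation.exists_isUniformizer_of_isCyclic_of_nontrivial (ValuativeRel.valuation ℚ_[p])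
  exact ⟨Units.mk0 (π : ℚ_[p]) hπ.ne_zero, hπ⟩

/-- **`ψ_e = ψ̄`**: any `e_G`-equivariant uniformiser-preserving `ψ : ℚ̄_pˣ ⥲ ℚ̄_pˣ` (the LCFT transport of [AbsAnab]
Prop. 1.2.1) COINCIDES with the extension `ψ_e` of the monoid component — by abc-iut-L6-t13's rigidity
`IsAlphaEquivariant.eq_or_eq_inv` the two differ at most by inversion, and inversion is excluded since `ψ_e`
preserves `|·|_p` (`norm_isoM`) while `ψ⁻¹(π)` of a uniformiser has norm `> 1`.
[cite: MochizukiAbsAnab2004, Prop 1.2.1 (vi) p.10] [cite: MochizukiAbsTopIII2015, Proposition 3.2 (iv) p.72] -/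
theorem extEquiv_eq_of_isAlphaEquivariant [IsNonarchimedeanLocalField ℚ_[p]]
    {ψ : (PadicAlgCl p)ˣ ≃* (PadicAlgCl p)ˣ} (hψ : Prop121vii.IsAlphaEquivariant (galComponent p e) ψ)
    (hU : Prop121vii.PreservesUniformizers ψ) : extEquiv p e = ψ := by
  rcases hψ.eq_or_eq_inv (extEquiv_isAlphaEquivariant p e) with h | h
  · exact h
  · exfalso
    obtain ⟨π₁, hπ₁⟩ := exists_unit_isUniformizer p
    obtain ⟨π₂, hπ₂, hψπ⟩ := hU π₁ hπ₁
    have hn1 : ‖(π₁ : ℚ_[p])‖ < 1 := norm_lt_one_of_isUniformizer p hπ₁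
    have hn2 : ‖(π₂ : ℚ_[p])‖ < 1 := norm_lt_one_of_isUniformizer p hπ₂
    set x : (PadicAlgCl p)ˣ := Units.map (algebraMap ℚ_[p] (PadicAlgCl p) : ℚ_[p] →* PadicAlgCl p) π₁ with hx_def
    have hxn : ‖(x : PadicAlgCl p)‖ = ‖(π₁ : ℚ_[p])‖ := PadicAlgCl.norm_extends p (π₁ : ℚ_[p])
    have hxO : (x : PadicAlgCl p) ∈ intMonoid (padicVal p) :=
      (mem_intMonoid_iff_norm p _).mpr ⟨x.ne_zero, by rw [hxn]; exact hn1.le⟩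
    have hx : x = intMonoidUnits p ⟨x, hxO⟩ := Units.ext rfl
    have h1 := h x
    rw [hψπ, hx, extEquiv_intMonoidUnits] at h1
    have h2 := congrArg (fun u : (PadicAlgCl p)ˣ => ‖(u : PadicAlgCl p)‖) h1
    simp only [coe_intMonoidUnits, Units.val_inv_eq_inv_val, norm_inv, Units.coe_map, MonoidHom.coe_coe] at h2
    rw [norm_isoM, PadicAlgCl.norm_extends p (π₂ : ℚ_[p])] at h2
    -- `h2 : ‖x‖ = ‖π₂‖⁻¹`, but `‖x‖ = ‖π₁‖ < 1 < ‖π₂‖⁻¹`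
    have hπ₂pos : 0 < ‖(π₂ : ℚ_[p])‖ := norm_pos_iff.mpr π₂.ne_zero
    have h3 : ‖(π₁ : ℚ_[p])‖ = ‖(π₂ : ℚ_[p])‖⁻¹ := by
      rw [← hxn]
      exact h2
    have h4 : (1 : ℝ) < ‖(π₂ : ℚ_[p])‖⁻¹ := one_lt_inv_iff₀.mpr ⟨hπ₂pos, hn2⟩
    rw [← h3] at h4
    exact absurd hn1 (not_lt.mpr h4.le)

/-- **Consequently `ψ_e` carries uniformisers of `ℚ_p` to uniformisers and `O^×_{ℚ̄_p}` onto `O^×_{ℚ̄_p}`**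
(the clauses of [AbsAnab] Prop. 1.2.1 (iii)/(iv) for THE transport, which exists by layer L4's
`Prop121vii.unitsTransport_holds` — local class field theory as proved in the tree).
[cite: MochizukiAbsAnab2004, Prop 1.2.1 (iv) p.10] -/
theorem extEquiv_preservesUniformizers [IsNonarchimedeanLocalField ℚ_[p]] :
    Prop121vii.PreservesUniformizers (extEquiv p e) ∧ Prop121vii.PreservesAbsUnits (extEquiv p e) := by
  obtain ⟨ψ, hψ, hA, hU⟩ := Prop121vii.unitsTransport_holds ℚ_[p] ℚ_[p] (galComponent p e)
  rw [extEquiv_eq_of_isAlphaEquivariant p e hψ hU]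
  exact ⟨hU, hA⟩

/-- **The monoid component of ANY automorphism of `(G_{ℚ_p} ↷ O^▷_{ℚ̄_p})` is the restriction of THE LCFT transport**
over its `G`-component: for every `e_G`-equivariant uniformiser-preserving `ψ`, `e_M(a) = ψ(a)` on `O^▷`
([AbsTopIII] Prop. 3.2 (iv) injectivity, in LANA's GM-data language and with the lift made explicit).
[cite: MochizukiAbsTopIII2015, Proposition 3.2 (iv) p.72] [cite: LANA2026Report, §5.3 (a) p. 29] -/
theorem coe_isoM_eq_of_isAlphaEquivariant [IsNonarchimedeanLocalField ℚ_[p]]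
    {ψ : (PadicAlgCl p)ˣ ≃* (PadicAlgCl p)ˣ} (hψ : Prop121vii.IsAlphaEquivariant (galComponent p e) ψ)
    (hU : Prop121vii.PreservesUniformizers ψ) (a : intMonoid (padicVal p)) :
    ((e.isoM a : intMonoid (padicVal p)) : PadicAlgCl p) = ((ψ (intMonoidUnits p a) : (PadicAlgCl p)ˣ) : PadicAlgCl p) := by
  rw [← extEquiv_eq_of_isAlphaEquivariant p e hψ hU, extEquiv_intMonoidUnits, coe_intMonoidUnits]

end PadicPairIso

/-! ## 2. Naturality of `ι_{G↷M}` -/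

section Natural

variable {k : Type} [Field k] [ValuativeRel k] [TopologicalSpace k] [IsNonarchimedeanLocalField k] [CharZero k]
  (D : TorsionReciprocityData k) {Γ₀ : Type} [LinearOrderedCommGroupWithZero Γ₀] (w : Valuation (AlgebraicClosure k) Γ₀)

omit [ValuativeRel k] [TopologicalSpace k] [IsNonarchimedeanLocalField k] [CharZero k] in
/-- **`Λ(ψ)` on `Λ(O^×)`** for ANY multiplicative `ψ : k̄ˣ →* k̄ˣ`: transport of `EtaleTheta.cyclotome.map ψ` along
`Λ(O^×) = Λ(k̄ˣ)` (roots of unity have valuation `1`, gen 5's `unitCyclotomeEquiv`; no hypothesis on `ψ`).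
[cite: LANA2026Report, §6.1 p. 32] -/
def unitCyclotomeCongr (ψ : (AlgebraicClosure k)ˣ →* (AlgebraicClosure k)ˣ) : unitCyclotome w →* unitCyclotome w :=
  ((unitCyclotomeEquiv w).symm.toMonoidHom.comp (EtaleTheta.cyclotome.map ψ)).comp (unitCyclotomeEquiv w).toMonoidHom

omit [ValuativeRel k] [TopologicalSpace k] [IsNonarchimedeanLocalField k] [CharZero k] in
/-- `Λ(ψ)` read in `Λ(k̄ˣ)` is `EtaleTheta.cyclotome.map ψ`. [cite: LANA2026Report, §6.1 p. 32] -/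
theorem unitCyclotomeEquiv_unitCyclotomeCongr (ψ : (AlgebraicClosure k)ˣ →* (AlgebraicClosure k)ˣ)
    (ζ : unitCyclotome w) :
    unitCyclotomeEquiv w (unitCyclotomeCongr w ψ ζ) = EtaleTheta.cyclotome.map ψ (unitCyclotomeEquiv w ζ) :=
  (unitCyclotomeEquiv w).apply_symm_apply _

/-- **[AbsTopIII] Rmk. 3.2.1 naturality of LANA's `ι_{G↷M}`** (for EVERY torsion reciprocity datum `D`): for every
topological automorphism `φ` of `G_k` and every `φ`-equivariant uniformiser-preserving `ψ : k̄ˣ ⥲ k̄ˣ`,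
`ι(Λ(ψ) ζ) = μ_Ẑ(φ)(ι ζ)` — the square "`Λ(O^×) → μ_Ẑ(G_k)`, transport of structure along `(φ, ψ)`" commutes.
Mechanism: abc-iut-L6-t11's `TorsionReciprocityData.muZhatEquiv_congr_natural` (the `Ẑ^×`-twist between two
data is invisible to naturality). [cite: MochizukiAbsTopIII2015, Remark 3.2.1 p.73] [cite: LANA2026Report, §6.3 (6-5) p. 37] -/
theorem iotaOfReciprocity_natural (φ : absoluteGaloisGroup k ≃ₜ* absoluteGaloisGroup k)
    (ψ : (AlgebraicClosure k)ˣ ≃* (AlgebraicClosure k)ˣ) (hψ : Prop121vii.IsAlphaEquivariant φ ψ)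
    (hU : Prop121vii.PreservesUniformizers ψ) (ζ : unitCyclotome w) :
    iotaOfReciprocity D w (unitCyclotomeCongr w ψ.toMonoidHom ζ) = muZhat.congr φ (iotaOfReciprocity D w ζ) := by
  apply D.muZhatEquiv.injective
  rw [muZhatEquiv_iotaOfReciprocity, D.muZhatEquiv_congr_natural φ ψ hψ hU, muZhatEquiv_iotaOfReciprocity,
    unitCyclotomeEquiv_unitCyclotomeCongr]

end Natural

section Padic

variable (p : ℕ) [Fact p.Prime]

/-- `G_{ℚ_p}`, in the spelling `Field.absoluteGaloisGroup ℚ_[p]`, preserves `| · |` on `ℚ̄_p` (gen 0's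
`isValPreserving_padic` for `PadicGal p`, same group). [cite: LANA2026Report, §3.5 p. 19] -/
theorem isValPreserving_absoluteGaloisGroup_padic : IsValPreserving (padicVal p) (absoluteGaloisGroup ℚ_[p]) :=
  ⟨fun σ x => (isValPreserving_padic p).val_smul ((PadicPairIso.padicGalAbs p).symm σ) x⟩

/-- **LANA's `ι_{G_v ↷ O^×_v}` at `ℚ_p` is NATURAL under EVERY automorphism of the GM-data `F_v = (G_{ℚ_p} ↷ O^▷_{ℚ̄_p})`**:
for every automorphism `e = (e_G, e_M)` of the pair and every `ζ ∈ Λ(O^×_{ℚ̄_p})`,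
`ι(Λ(ψ_e) ζ) = μ_Ẑ(e_G)(ι ζ)`, where `ψ_e` is the extension of `e_M` to `ℚ̄_pˣ` (so `Λ(ψ_e) = Λ(e_M|_{O^×})`) —
the rigidity isomorphism is compatible with transport of structure, "canonical" in the mono-anabelian sense.
[cite: LANA2026Report, §6.3 (6-5) p. 37] [cite: MochizukiAbsTopIII2015, Remark 3.2.1 p.73] -/
theorem iotaOfReciprocity_natural_padicPair [IsNonarchimedeanLocalField ℚ_[p]] (D : TorsionReciprocityData ℚ_[p])
    (e : GaloisMonoidPair.Iso (padicPair p) (padicPair p)) (ζ : unitCyclotome (padicVal p)) :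
    iotaOfReciprocity D (padicVal p) (unitCyclotomeCongr (padicVal p) (PadicPairIso.extEquiv p e).toMonoidHom ζ) =
      muZhat.congr (PadicPairIso.galComponent p e) (iotaOfReciprocity D (padicVal p) ζ) :=
  iotaOfReciprocity_natural D (padicVal p) (PadicPairIso.galComponent p e) (PadicPairIso.extEquiv p e)
    (PadicPairIso.extEquiv_isAlphaEquivariant p e) (PadicPairIso.extEquiv_preservesUniformizers p e).1 ζ

/-- The components of `Λ(ψ_e) ζ` ARE `e_M` applied to the components of `ζ` (roots of unity lie in `O^× ⊆ O^▷`,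
where `ψ_e = e_M`). [cite: LANA2026Report, §6.1 p. 32] -/
theorem coe_unitCyclotomeCongr_extEquiv (e : GaloisMonoidPair.Iso (padicPair p) (padicPair p))
    (ζ : unitCyclotome (padicVal p)) (n : ℕ+) :
    ((((unitCyclotomeCongr (padicVal p) (PadicPairIso.extEquiv p e).toMonoidHom ζ : unitCyclotome (padicVal p)) :
        ℕ+ → unitGrp (padicVal p)) n : (PadicAlgCl p)ˣ) : PadicAlgCl p) =
      ((e.isoM ⟨(((ζ : ℕ+ → unitGrp (padicVal p)) n : (PadicAlgCl p)ˣ) : PadicAlgCl p),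
          val_mem_intMonoid (padicVal p) ((ζ : ℕ+ → unitGrp (padicVal p)) n)⟩ : intMonoid (padicVal p)) :
        PadicAlgCl p) := by
  have h := congrArg (fun ξ : EtaleTheta.cyclotome (PadicAlgCl p)ˣ => (((ξ : ℕ+ → (PadicAlgCl p)ˣ) n : (PadicAlgCl p)ˣ) : PadicAlgCl p))
    (unitCyclotomeEquiv_unitCyclotomeCongr (padicVal p) (PadicPairIso.extEquiv p e).toMonoidHom ζ)
  simp only [unitCyclotomeEquiv_apply_coe, EtaleTheta.cyclotome.map_apply, MulEquiv.coe_toMonoidHom] at h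
  rw [h]
  have h2 := PadicPairIso.extEquiv_intMonoidUnits p e
    ⟨_, val_mem_intMonoid (padicVal p) ((ζ : ℕ+ → unitGrp (padicVal p)) n)⟩
  have hu : PadicPairIso.intMonoidUnits p ⟨_, val_mem_intMonoid (padicVal p) ((ζ : ℕ+ → unitGrp (padicVal p)) n)⟩ =
      ((ζ : ℕ+ → unitGrp (padicVal p)) n : (PadicAlgCl p)ˣ) := Units.ext rfl
  rw [hu] at h2
  exact congrArg Units.val h2

end Padic

/-! ## 3. NEGATIVE companion: the unit GM-data `F^{⊢×}_v = (G_v ↷ O^×_v)` does NOT rigidify `Λ` -/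

section Negative

variable {K : Type} [Field K] {Γ₀ : Type} [LinearOrderedCommGroupWithZero Γ₀] (w : Valuation K Γ₀)
  (G : Type) [Group G] [MulSemiringAction G K] [IsValPreserving w G]

/-- **Inversion is an automorphism of the unit GM-data over `e_G = id`**: `u ↦ u⁻¹` on `O^×_v` commutes with the
`G_v`-action (any group automorphism action does). [cite: LANA2026Report, §3.6 p. 19] -/
theorem unitGrpInv_smul (g : G) (u : unitGrp w) : MulEquiv.inv (unitGrp w) (g • u) = g • MulEquiv.inv (unitGrp w) u :=
  (smul_inv' g u).symm

omit [IsValPreserving w G] in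
/-- `Λ(inv)` is inversion on `Λ(O^×)` (componentwise). [cite: LANA2026Report, §6.1 p. 32] -/
theorem cyclotome_map_inv (ζ : unitCyclotome w) :
    EtaleTheta.cyclotome.map (MulEquiv.inv (unitGrp w)).toMonoidHom ζ = ζ⁻¹ :=
  Subtype.ext (funext fun _ => rfl)

variable {k : Type} [Field k] [CharZero k] (D : TorsionReciprocityData k)
  {Γ₁ : Type} [LinearOrderedCommGroupWithZero Γ₁] (v : Valuation (AlgebraicClosure k) Γ₁)

/-- **Under the inversion automorphism of `F^{⊢×}_v`, `ι` picks up the sign `-1 ∈ Ẑ^×`**: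
`ι(Λ(inv) ζ) = (ι ζ)⁻¹` — whereas naturality over `e_G = id` would demand `ι(Λ(inv) ζ) = μ_Ẑ(id)(ι ζ) = ι ζ`.
[cite: MochizukiAbsTopIII2015, Proposition 3.3 (i) p.73] [cite: LANA2026Report, §6.3 (6-5) p. 37] -/
theorem iotaOfReciprocity_cyclotome_map_inv (ζ : unitCyclotome v) :
    iotaOfReciprocity D v (EtaleTheta.cyclotome.map (MulEquiv.inv (unitGrp v)).toMonoidHom ζ) = (iotaOfReciprocity D v ζ)⁻¹ := by
  rw [cyclotome_map_inv, map_inv]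

/-- **`Λ(O^×_{ℚ̄_p})` has an element of order `> 2`**: a generator `ξ` (primitive `n`-th roots in every component, the
tree's `EtaleTheta.cyclotome.exists_generator`) satisfies `ξ ≠ ξ⁻¹` — its third component is a primitive cube root of unity.
[cite: RibesZalesskii2010, Thm 2.7.1] -/
theorem exists_unitCyclotome_ne_inv (p : ℕ) [Fact p.Prime] :
    ∃ ζ : unitCyclotome (padicVal p), ζ ≠ ζ⁻¹ := by
  obtain ⟨ξ, hξ⟩ := EtaleTheta.cyclotome.exists_generator (R := PadicAlgCl p)
    (EtaleTheta.cyclotome.exists_isPrimitiveRoot_of_isSepClosed (PadicAlgCl p))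
  refine ⟨(unitCyclotomeEquiv (padicVal p)).symm ξ, fun h => ?_⟩
  have h3 := hξ 3
  have h' : ξ = ξ⁻¹ := by
    have := congrArg (unitCyclotomeEquiv (padicVal p)) h
    rwa [map_inv, MulEquiv.apply_symm_apply] at this
  have hsq : ((ξ : ℕ+ → (PadicAlgCl p)ˣ) 3) ^ 2 = 1 := by
    have hc := congrArg (fun ζ : EtaleTheta.cyclotome (PadicAlgCl p)ˣ => (ζ : ℕ+ → (PadicAlgCl p)ˣ) 3) h'
    simp only [Subgroup.coe_inv, Pi.inv_apply] at hc
    rw [pow_two, ← eq_inv_iff_mul_eq_one]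
    exact hc
  have hdvd := h3.dvd_of_pow_eq_one 2 hsq
  norm_num at hdvd

/-- **LANA's `ι_{G_v ↷ O^×_v}` is NOT natural under the automorphisms of the UNIT GM-data `F^{⊢×}_v`**: the
`G_{ℚ_p}`-equivariant automorphism `inv` of `O^×_{ℚ̄_p}` (lying over `e_G = id`) does NOT satisfy
`ι(Λ(inv) ζ) = ι ζ` for all `ζ` — the `-1 ∈ Ẑ^×` of print's indeterminacy ("only determined up to a `Ẑ^×`-multiple
if `T = TCG`").  Contrast §2: over the valuation-bearing monoid `O^▷` every automorphism IS compatible with `ι`.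
[cite: MochizukiAbsTopIII2015, Proposition 3.3 (i) p.73] [cite: LANA2026Report, §6.3 (6-5) p. 37] -/
theorem not_iota_natural_unitGrpInv (p : ℕ) [Fact p.Prime] (D : TorsionReciprocityData ℚ_[p]) :
    ¬ ∀ ζ : unitCyclotome (padicVal p),
      iotaOfReciprocity D (padicVal p) (EtaleTheta.cyclotome.map (MulEquiv.inv (unitGrp (padicVal p))).toMonoidHom ζ) =
        iotaOfReciprocity D (padicVal p) ζ := by
  intro h
  obtain ⟨ζ, hζ⟩ := exists_unitCyclotome_ne_inv p
  have h1 := h ζ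
  rw [iotaOfReciprocity_cyclotome_map_inv, inv_eq_iff_eq_inv, ← map_inv] at h1
  exact hζ ((iotaOfReciprocity D (padicVal p)).injective h1)

end Negative

end IUTFork

end Summit.ABC

end
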